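import Mathlib
import HarnessLib
import Literature.NumberTheory.Automorphic.ClozelPurityProofs

/-!
# Stub `stub_purityGap` of line `potaut` (crux `LocallyReducibleParallel`, stmt-Langlands-17002)

For a cuspidal `Π` on `GL₂(𝔸_K)` (any number field `K`) with a regular algebraic infinity type `T`,
at every complex embedding `s` the multiset of `a`-exponents of `T` is `{a, a + g}` and at
`conj ∘ s` it is `{a', a' + g}` with the SAME `g ∈ ℕ`.  Pure bookkeeping over the PROVED tree
theorem `Literature.NumberTheory.Automorphic.CuspidalAutomorphicRepData.purity` (Clozel 1990,
Lemme 4.9 on multisets): `T s` has two entries (well formed) with distinct (regular) `a`-exponents in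
`1/2 + ℤ` (C-algebraic), so they are `a, a + g` with `0 < g ∈ ℕ`, and purity reflects them through
`t ↦ w - t` for one `w ∈ ℤ`, which preserves the gap.
-/

set_option linter.dupNamespace false

namespace Summit.Langlands.Langlands.Cruxes.LocallyReducibleParallel.Potaut

open Literature.NumberTheory.Automorphic

/-- Two complex numbers `x = k + c`, `y = l + c` in the same `ℤ`-coset with `k < l` form the pair
`{x, x + g}` with `g = l - k ∈ ℕ`, and their reflections `{w - x, w - y}` form the pair
`{(w - y), (w - y) + g}` with the same `g`. [folklore] -/
private theorem pair_eq_gap_of_lt {x y c : ℂ} {k l : ℤ} (hx : x = k + c) (hy : y = l + c)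
    (hkl : k < l) (w : ℂ) :
    ∃ (g : ℕ) (a a' : ℂ), ({x, y} : Multiset ℂ) = {a, a + (g : ℂ)} ∧
      ({w - x, w - y} : Multiset ℂ) = {a', a' + (g : ℂ)} := by
  have hg : (((l - k).toNat : ℕ) : ℂ) = (l : ℂ) - k := by
    rw [← Int.cast_natCast, Int.toNat_of_nonneg (sub_nonneg.mpr hkl.le), Int.cast_sub]
  refine ⟨(l - k).toNat, x, w - y, ?_, ?_⟩
  · have hxy : x + (((l - k).toNat : ℕ) : ℂ) = y := by rw [hg, hx, hy]; ring
    rw [hxy]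
  · have hxy : w - y + (((l - k).toNat : ℕ) : ℂ) = w - x := by rw [hg, hx, hy]; ring
    rw [hxy, Multiset.pair_comm]

/-- **Purity pairs the gaps at conjugate embeddings.**  For ANY number field `K` and a cuspidal `Π`
on `GL₂(𝔸_K)` with a regular algebraic infinity type `T`: at every embedding `s : K → ℂ` the
`a`-multiset of `T` is `{a, a + g}` and at `conj ∘ s` it is `{a', a' + g}` with the SAME `g ∈ ℕ`.
Proof: `T s` has two entries (well-formed) whose `a`-exponents are distinct (regular) and congruent
mod `ℤ` (both in `1/2 + ℤ`, C-algebraic), so they are `a, a + g` with `g ∈ ℕ`; Clozel's purity lemma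
(tree theorem `CuspidalAutomorphicRepData.purity`) gives `w ∈ ℤ` with
`a-multiset at conj ∘ s = {w − t : t ∈ a-multiset at s} = {w − a − g, (w − a − g) + g}`.
[cite: Clozel1990, Lemme 4.9] -/
theorem stub_purityGap : ∀ (K : Type) [Field K] [NumberField K] (hcpt : Literature.NumberTheory.Automorphic.isCompact_glFiniteIntegralLevel 2 K) (π : Literature.NumberTheory.Automorphic.CuspidalAutomorphicRepData 2 K hcpt) (T : Literature.NumberTheory.Automorphic.InfinityType K 2), π.1.HasInfinityType T → T.IsRegularAlgebraic → ∀ s : K →+* ℂ, ∃ (g : ℕ) (a a' : ℂ), (T s).map Literature.NumberTheory.Automorphic.ArchWeight.a = {a, a + (g : ℂ)} ∧ (T ((starRingEnd ℂ).comp s)).map Literature.NumberTheory.Automorphic.ArchWeight.a = {a', a' + (g : ℂ)} := by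
  intro K _ _ hcpt π T hT hreg s
  -- Clozel purity: one integer `w` reflecting the `a`-multisets at conjugate embeddings
  obtain ⟨w, hw⟩ := π.purity hT hreg
  -- the `a`-multiset at `s` has exactly two entries
  have hcard : Multiset.card ((T s).map ArchWeight.a) = 2 := by
    rw [Multiset.card_map, hT.1.1 s]
  obtain ⟨x, y, hxy⟩ := Multiset.card_eq_two.mp hcard
  -- hence the `a`-multiset at `conj ∘ s` is `{w - x, w - y}`
  have hconj : (T ((starRingEnd ℂ).comp s)).map ArchWeight.a = {(w : ℂ) - x, (w : ℂ) - y} := by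
    rw [hw s, hxy]
    rfl
  -- both entries are half-integers `k + 1/2`, `l + 1/2`
  have hx : x ∈ (T s).map ArchWeight.a := by
    rw [hxy]
    exact Multiset.mem_cons_self _ _
  have hy : y ∈ (T s).map ArchWeight.a := by
    rw [hxy]
    exact Multiset.mem_cons_of_mem (Multiset.mem_singleton_self _)
  obtain ⟨P, hP, hPx⟩ := Multiset.mem_map.mp hx
  obtain ⟨k, -, hk, -⟩ := hreg.1 s P hP
  rw [hPx] at hk
  obtain ⟨Q, hQ, hQy⟩ := Multiset.mem_map.mp hy
  obtain ⟨l, -, hl, -⟩ := hreg.1 s Q hQ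
  rw [hQy] at hl
  -- and they are distinct (regularity), so `k ≠ l`
  have hnd := hreg.2 s
  rw [hxy] at hnd
  have hne : x ≠ y := by
    simpa [Multiset.insert_eq_cons, Multiset.nodup_cons] using hnd
  have hkl : k ≠ l := by
    rintro rfl
    exact hne (hk.trans hl.symm)
  rw [hxy, hconj]
  rcases lt_or_gt_of_ne hkl with h | h
  · exact pair_eq_gap_of_lt hk hl h _
  · obtain ⟨g, a, a', h₁, h₂⟩ := pair_eq_gap_of_lt hl hk h (w : ℂ)
    exact ⟨g, a, a', (Multiset.pair_comm _ _).trans h₁, (Multiset.pair_comm _ _).trans h₂⟩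

end Summit.Langlands.Langlands.Cruxes.LocallyReducibleParallel.Potaut
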